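import Mathlib
import Literature.Analysis.Matrix.ABvsBAEigenvalues

/-!
# Venture YMGap, track Y3 FLOW-DATA — the kept-set BLOCK has the padded spectrum of the compressed matrix

HONEST FRAMING: venture file of the cell `pub-ymgap` (QuantumFields programme), track Y3, companion of
`FlowData/KWeightTailTheorem.lean` (the K-weight tail theorem of lineage B, flow-ref FR-18).  That theorem compares
the full transfer matrix `S = K^{1/2} V K^{1/2}` with the ZERO-PADDED `n × n` compression
`S_T = K_T^{1/2} V K_T^{1/2}` (zero rows and columns off the kept set `T = {p}`).  What the engine certifies is the
`|T| × |T|` BLOCK `B_T = (√K_a V_ab √K_b)_{a,b ∈ T}`.  This file closes that gap: for every `k < |T|` the `k`-th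
largest eigenvalue of `S_T` equals the `k`-th largest eigenvalue of `B_T` (`eigenvalues₀_compressed_eq_block`) —
Horn–Johnson Thm. 1.3.22 once more (`Z Zᵀ` vs `Zᵀ Z` for the rectangular `Z` = the kept rows of
`K_T^{1/2} V^{1/2}`, tree `ABvsBAEigenvalues.paddedEigenvalues_conjTranspose_mul_self`).  Finite real matrices
only; no lattice object, no number, no row, nothing about limits or a mass gap.

References: R. A. Horn, C. R. Johnson, *Matrix Analysis*, 2nd ed. (2013), Thm. 1.3.22 [cite: HornJohnson2013,
Thm 1.3.22]; the cell's FLOW-REFEREE.md FR-18 (2026-08-22).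
-/

noncomputable section

open scoped MatrixOrder
open Matrix

namespace Summit.Ventures.YMGap.FlowData

namespace KWeightTail

variable {n : Type*} [Fintype n] [DecidableEq n]

/-- Sorted eigenvalues depend on the matrix only (transport along an equality of matrices). [folklore] -/
theorem eigenvalues₀_eq_of_eq {m : Type*} [Fintype m] [DecidableEq m] {A B : Matrix m m ℝ} (hAB : A = B)
    (hA : A.IsHermitian) (hB : B.IsHermitian) : hA.eigenvalues₀ = hB.eigenvalues₀ := by
  subst hAB; rfl

omit [DecidableEq n] in
/-- If the rows of `X` off the kept set vanish, `Xᵀ X` only sees the kept rows `Z`: `Xᵀ X = Zᵀ Z`. [folklore] -/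
theorem conjTranspose_mul_self_eq_keptRows (X : Matrix n n ℝ) (p : n → Prop) [DecidablePred p]
    (hX : ∀ i, ¬ p i → ∀ j, X i j = 0) :
    Xᴴ * X = (X.submatrix (Subtype.val : {i // p i} → n) id)ᴴ * X.submatrix (Subtype.val : {i // p i} → n) id := by
  ext a b
  rw [mul_apply, mul_apply]
  simp only [conjTranspose_apply, submatrix_apply, id_eq, star_trivial]
  rw [← Fintype.sum_subtype_add_sum_subtype p (fun i => X i a * X i b)]
  have h0 : ∑ i : {x // ¬ p x}, X i a * X i b = 0 :=
    Finset.sum_eq_zero fun i _ => by rw [hX i i.2 a, zero_mul]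
  rw [h0, add_zero]

omit [DecidableEq n] in
/-- The kept block of `X Xᵀ` is `Z Zᵀ` with `Z` the kept rows of `X`. [folklore] -/
theorem submatrix_mul_conjTranspose_self (X : Matrix n n ℝ) (p : n → Prop) :
    (X * Xᴴ).submatrix (Subtype.val : {i // p i} → n) (Subtype.val : {i // p i} → n) =
      X.submatrix (Subtype.val : {i // p i} → n) id * (X.submatrix (Subtype.val : {i // p i} → n) id)ᴴ := by
  rw [conjTranspose_submatrix, ← submatrix_mul _ _ _ id _ Function.bijective_id]

/-- **Padded spectrum = block spectrum.** If the rows of `X` off the kept set `p` vanish, then for every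
`k < |{p}|` the `k`-th largest eigenvalue of the `n × n` matrix `X Xᵀ` equals the `k`-th largest eigenvalue of its
kept `|{p}| × |{p}|` block (Horn–Johnson Thm. 1.3.22: `X Xᵀ ~ Xᵀ X = Zᵀ Z ~ Z Zᵀ` up to zeros, `Z` = kept rows).
[cite: HornJohnson2013, Thm 1.3.22] -/
theorem eigenvalues₀_mul_conjTranspose_self_eq_block (X : Matrix n n ℝ) (p : n → Prop) [DecidablePred p]
    (hX : ∀ i, ¬ p i → ∀ j, X i j = 0) (k : ℕ) (hk : k < Fintype.card {i // p i}) :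
    (isHermitian_mul_conjTranspose_self X).eigenvalues₀ ⟨k, lt_of_lt_of_le hk (Fintype.card_subtype_le p)⟩ =
      (isHermitian_mul_conjTranspose_self (X.submatrix (Subtype.val : {i // p i} → n) id)).eigenvalues₀
        ⟨k, hk⟩ := by
  set Z : Matrix {i // p i} n ℝ := X.submatrix (Subtype.val : {i // p i} → n) id with hZ
  have h1 := Literature.Analysis.Matrix.ABvsBAEigenvalues.paddedEigenvalues_conjTranspose_mul_self X
  have h2 := Literature.Analysis.Matrix.ABvsBAEigenvalues.paddedEigenvalues_conjTranspose_mul_self Z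
  -- `Xᵀ X = Zᵀ Z` as matrices, hence equal padded spectra (proof-irrelevant in the Hermitian witness)
  have h3 : Literature.Analysis.Matrix.ABvsBAEigenvalues.paddedEigenvalues (isHermitian_conjTranspose_mul_self X) =
      Literature.Analysis.Matrix.ABvsBAEigenvalues.paddedEigenvalues (isHermitian_conjTranspose_mul_self Z) := by
    have hm : Xᴴ * X = Zᴴ * Z := conjTranspose_mul_self_eq_keptRows X p hX
    -- transport along the matrix equality
    have : ∀ (A B : Matrix n n ℝ) (hAB : A = B) (hA : A.IsHermitian) (hB : B.IsHermitian),
        Literature.Analysis.Matrix.ABvsBAEigenvalues.paddedEigenvalues hA =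
          Literature.Analysis.Matrix.ABvsBAEigenvalues.paddedEigenvalues hB := by
      intro A B hAB hA hB; subst hAB; rfl
    exact this _ _ hm _ _
  have h4 := congrFun (h1.symm.trans (h3.trans h2)) k
  -- h4 : padded(X Xᵀ) k = padded(Z Zᵀ) k ; evaluate both sides inside their ranges
  rwa [Literature.Analysis.Matrix.ABvsBAEigenvalues.paddedEigenvalues_of_lt _
      (lt_of_lt_of_le hk (Fintype.card_subtype_le p)),
    Literature.Analysis.Matrix.ABvsBAEigenvalues.paddedEigenvalues_of_lt _ hk] at h4

/-! ### The kstm shape: `S_T = K_T^{1/2} V K_T^{1/2}` and its kept block `(√K_a V_ab √K_b)_{a, b ∈ T}` -/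

section Compressed

variable {V : Matrix n n ℝ} (hV : V.PosSemidef) (K : n → ℝ) (p : n → Prop) [DecidablePred p]

/-- `S_T` is symmetric. [folklore] -/
theorem isHermitian_compressed' (hV : V.IsHermitian) :
    ((diagonal fun i => if p i then Real.sqrt (K i) else (0 : ℝ)) * V *
      (diagonal fun i => if p i then Real.sqrt (K i) else (0 : ℝ))).IsHermitian := by
  have h := isHermitian_conjTranspose_mul_mul (diagonal fun i => if p i then Real.sqrt (K i) else (0 : ℝ)) hV
  rwa [(isHermitian_diagonal_of_self_adjoint _ (IsSelfAdjoint.all _)).eq] at h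

/-- The kept block `B_T = K^{1/2}|_T · V|_{T×T} · K^{1/2}|_T` is symmetric. [folklore] -/
theorem isHermitian_block (hV : V.IsHermitian) :
    (diagonal (fun a : {i // p i} => Real.sqrt (K a)) * V.submatrix (Subtype.val : {i // p i} → n) (Subtype.val : {i // p i} → n) *
      diagonal (fun a : {i // p i} => Real.sqrt (K a))).IsHermitian := by
  have h := isHermitian_conjTranspose_mul_mul (diagonal fun a : {i // p i} => Real.sqrt (K a))
    (hV.submatrix (Subtype.val : {i // p i} → n))
  rwa [(isHermitian_diagonal_of_self_adjoint _ (IsSelfAdjoint.all _)).eq] at h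

/-- The kept block of `S_T` is `B_T`. [folklore] -/
theorem submatrix_compressed :
    ((diagonal fun i => if p i then Real.sqrt (K i) else (0 : ℝ)) * V *
        (diagonal fun i => if p i then Real.sqrt (K i) else (0 : ℝ))).submatrix
        (Subtype.val : {i // p i} → n) (Subtype.val : {i // p i} → n) =
      diagonal (fun a : {i // p i} => Real.sqrt (K a)) * V.submatrix (Subtype.val : {i // p i} → n) (Subtype.val : {i // p i} → n) *
        diagonal (fun a : {i // p i} => Real.sqrt (K a)) := by
  ext a b
  have ha : p a.1 := a.2
  have hb : p b.1 := b.2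
  simp only [submatrix_apply, mul_diagonal, diagonal_mul, if_pos ha, if_pos hb]

/-- **Kept block = padded compression, spectrally.** For positive semidefinite `V`, weights `K` and a kept set
`T = {p}`: for every `k < |T|`, the `k`-th largest eigenvalue of the zero-padded `S_T = K_T^{1/2} V K_T^{1/2}`
equals the `k`-th largest eigenvalue of the `|T| × |T|` block `B_T = (√K_a V_ab √K_b)_{a,b∈T}` that the engine
builds and certifies — so `FlowData/KWeightTailTheorem.eigenvalues₀_mem_Icc` applies verbatim to the block's
eigenvalues. [cite: HornJohnson2013, Thm 1.3.22] -/
theorem eigenvalues₀_compressed_eq_block (k : ℕ) (hk : k < Fintype.card {i // p i}) :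
    (isHermitian_compressed' K p hV.isHermitian).eigenvalues₀
        ⟨k, lt_of_lt_of_le hk (Fintype.card_subtype_le p)⟩ =
      (isHermitian_block K p hV.isHermitian).eigenvalues₀ ⟨k, hk⟩ := by
  -- write S_T = X Xᵀ with X = K_T^{1/2} V^{1/2}, whose rows off T vanish
  set R : Matrix n n ℝ := CFC.sqrt V with hR
  have hRR : R * R = V := CFC.sqrt_mul_sqrt_self V (Matrix.nonneg_iff_posSemidef.mpr hV)
  have hRH : Rᴴ = R := ((CFC.sqrt_nonneg V).isSelfAdjoint : IsSelfAdjoint R).star_eq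
  set D : Matrix n n ℝ := diagonal fun i => if p i then Real.sqrt (K i) else (0 : ℝ) with hD
  have hDH : Dᴴ = D := (isHermitian_diagonal_of_self_adjoint _ (IsSelfAdjoint.all _)).eq
  set X : Matrix n n ℝ := D * R with hXdef
  have hS : D * V * D = X * Xᴴ := by
    rw [hXdef, conjTranspose_mul, hRH, hDH, ← hRR]; simp only [Matrix.mul_assoc]
  have hX0 : ∀ i, ¬ p i → ∀ j, X i j = 0 := by
    intro i hi j
    rw [hXdef, hD, diagonal_mul]
    simp [hi]
  have hmain := eigenvalues₀_mul_conjTranspose_self_eq_block X p hX0 k hk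
  -- transport: S_T = X Xᵀ and block(S_T) = Z Zᵀ
  have hblk : (X * Xᴴ).submatrix (Subtype.val : {i // p i} → n) (Subtype.val : {i // p i} → n) =
      diagonal (fun a : {i // p i} => Real.sqrt (K a)) * V.submatrix (Subtype.val : {i // p i} → n) (Subtype.val : {i // p i} → n) *
        diagonal (fun a : {i // p i} => Real.sqrt (K a)) := by
    rw [← hS]; exact submatrix_compressed K p
  have hZ : (X * Xᴴ).submatrix (Subtype.val : {i // p i} → n) (Subtype.val : {i // p i} → n) =
      X.submatrix (Subtype.val : {i // p i} → n) id * (X.submatrix (Subtype.val : {i // p i} → n) id)ᴴ := submatrix_mul_conjTranspose_self X p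
  have e1 := eigenvalues₀_eq_of_eq hS (isHermitian_compressed' K p hV.isHermitian)
    (isHermitian_mul_conjTranspose_self X)
  have e2 := eigenvalues₀_eq_of_eq (hblk.symm.trans hZ) (isHermitian_block K p hV.isHermitian)
    (isHermitian_mul_conjTranspose_self _)
  exact (congrFun e1 _).trans (hmain.trans (congrFun e2 _).symm)

end Compressed

end KWeightTail

end Summit.Ventures.YMGap.FlowData
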